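import Summits.BirchSwinnertonDyer.BirchSwinnertonDyer.Theorems.KolyvaginDepthDoorDepthTableKurihara
import Literature.NumberTheory.EllipticCurves.KuriharaNumberInvariants
import Literature.NumberTheory.EllipticCurves.KuriharaNumberKimModPSelmerBound
import Literature.NumberTheory.EllipticCurves.Sakamoto2024.KuriharaStructureAtThree
import Summits.BirchSwinnertonDyer.BirchSwinnertonDyer.Theorems.KimAtThreeDeepUpperEndCore
import HarnessLib
import Literature.NumberTheory.EllipticCurves.KuriharaNumberSakamotoPSelmerStructure

/-!
# Route `KolyvaginDepthDoor`, crux `KolyvaginDepthSupplyKN` (stmt-BirchSwinnertonDyer-22820) —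
# DEPTH TABLE v18, GENERIC (part 1 of 3): THE EXACT KURIHARA READING — the two new print inputs
# (Sakamoto, Doc. Math. 27 (2022), Thm. 1.2 / Thm. 1.5 BY NAME, cyclic levels) and the `δ`-minimal mechanism

Helper file of the lead prover of line `levelone` (kdd-p1 g22; `--supports stmt-BirchSwinnertonDyer-22820
--as helper`); it closes nothing and BSD is NOT proved by it.

WHAT IS NEW. v17 (g21, `KolyvaginDepthDoorDepthTableKurihara`) reads every row of the depth table ONE WAY: a
unit mod-`p` Kurihara number of `E` at a cyclic level of depth `≤ rank E` and one of a minimal model `T` of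
the Heegner twist at a cyclic level of depth `≤ rank E` IMPLY the clause of the crux at `(E, p, K)` (Kim,
Amer. J. Math. 148 (2026) Thm. 1.11 = the bound `#Sel_p ≤ p^{ν(n)}`, fact `hKim`). v18 makes the reading
TWO-WAY («ONE ANTICYCLOTOMIC BIT ⟺ TWO CYCLOTOMIC BITS», sequel files `…KuriharaExactSides`,
`…KuriharaExactRow`). The converse needs the EXISTENCE of unit levels and the EXACT count at a `δ`-minimal
level, both on the cyclic levels `𝒩_{1,0}` of Kurihara / Sakamoto (the tree's `IsCyclicKolyvaginLevel`),
i.e. two printed theorems NEW to the tree at `p ≥ 5` (their `p = 3` twins are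
`Sakamoto2024.thm911_mainIdentity_iff_exists_deltaMinimal` / `…card_selmerGroup_three_eq_of_isDeltaMinimal`):

* `Sakamoto2022_exists_cyclicLevel_kuriharaNumber_ne_zero` (§0) — R. Sakamoto, *`p`-Selmer group and
  modular symbols*, Doc. Math. 27 (2022), **Thm. 1.2** (= Cor. 4.3): Kurihara's Conjecture 1.1 «some
  `d ∈ 𝒩_{1,0}` has `δ̃_d ≠ 0`» ⟺ the Iwasawa main conjecture for `E/ℚ` — a THEOREM at a good ordinary
  `p ≥ 5` with `ρ̄_{E,p}` onto (Kato 2004 Thm. 17.4 (3) + Burungale–Castella–Skinner 2025 Thm. 1.1.2 (b),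
  the audit of `Kim2022_kuriharaNumber_certificate`); the CYCLIC-level twin of the tree's
  `Kim2022_exists_kuriharaNumber_modP_ne_zero`.
* `Sakamoto2022_card_selmerGroup_eq_pow_of_isDeltaMinimal` (§0) — **Thm. 1.5** (= Thm. 4.8; Kurihara 2014
  Conj. 1.2.4; Kim Thm. 1.11 "in this case … is an isomorphism"): at a `δ`-MINIMAL `d ∈ 𝒩_{1,0}`
  (`Sakamoto2024.IsDeltaMinimal`) `Sel(ℚ, E[p]) ≅ ⨁_{ℓ∣d} E(ℚ_ℓ) ⊗ 𝔽_p`, so `#Sel_p(E/ℚ) = p^{ν(d)}`.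

THEOREMS here (per `(W, p)`; a «Kurihara bit of depth `≤ r`» is stated «for EVERY modular parametrisation
datum `D` at level `N_E` with `p ∤ c_D` and the period transfer, SOME cyclic level `n` with `ν(n) ≤ r`
carries a unit» — the shape of `KuriharaCertificates.Record.Claim`, which is the case of a fixed level):
§1 `exists_isDeltaMinimal_dvd_of_kuriharaNumber_ne_zero` (a unit level has a `δ`-minimal divisor; pure);
§2 `rank_le_card_primeFactors_and_sha_iff_of_isDeltaMinimal` («at a `δ`-minimal cyclic level `d`:
`rank E ≤ ν(d)`, and `Ш(E/ℚ)[p] = 0 ⟺ ν(d) = rank E`»), `natCard_selmerGroup_le_pow_of_kuriharaBit` (`⟸`: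
a bit of depth `≤ r` gives `#Sel_p(E) ≤ p^r`, Kim), `exists_isDeltaMinimal_of_natCard_selmerGroup_le_pow`
(`⟹`: `#Sel_p(E) ≤ p^r` gives a `δ`-minimal cyclic level of depth `≤ r` for every admissible datum, Sakamoto).

CONDITIONAL on the named facts displayed as hypotheses (`hKim`, `hSak1`, `hSak2`, modularity `hnf`, Mazur
1978 Cor. 4.1 `hMaz`); per `(W, p)`; nothing class-wide (the open stub (S♭) is untouched); BSD is NOT
proved by any of this.

References: [Sakamoto2022pSelmer] R. Sakamoto, Doc. Math. 27 (2022) 1891–1922 = arXiv:2106.03370, §1 (a)–(c),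
Conj. 1.1, Thm. 1.2, Def. 1.4, Thm. 1.5, Rem. 1.6, Prop. 3.16, Cor. 4.3, Thm. 4.8; [Kim2022StructureSelmer] C.-H. Kim,
Amer. J. Math. 148 (2026) 79–129 = arXiv:2203.12159, Thm. 1.11, §1.2.2, §1.4, §6; [Kurihara2014] M. Kurihara,
Contrib. Math. Comput. Sci. 7 (2014) = arXiv:1407.2465, Thm. 1.2.3, Conj. 1.2.4; [BurungaleCastellaSkinner2025]
Thm. 1.1.2 (b); [Kato2004Asterisque] Thm. 17.4; [Mazur1978] Cor. 4.1; [WZhang2014] Lemma 8.4 (1), Thm. 9.1;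
[GrossLMS1991] Prop. 3.7 (2); [SilvermanAEC2009] X.4.2, X.5 Cor. 5.4.
-/

set_option linter.dupNamespace false

noncomputable section

open scoped Classical NumberField

/-! ## §0 The two new named print inputs (Sakamoto 2022, Thm. 1.2 and Thm. 1.5, at `p ≥ 5`), BY NAME -/

namespace Summit.BirchSwinnertonDyer.BirchSwinnertonDyer.Theorems.KolyvaginDepthDoor

open Literature.NumberTheory.EllipticCurves Literature.NumberTheory.EllipticCurves.ModularForms
  WeierstrassCurve NumberField IsDedekindDomain CongruenceSubgroup
open Summit.BirchSwinnertonDyer.BirchSwinnertonDyer.Theorems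

/-! ## §1 From a unit level to a `δ`-minimal level (pure bookkeeping; divisors of cyclic levels are cyclic levels —
the tree's `KimAtThreeDeepUpperEndCore.EndCore.isCyclicKolyvaginLevel_of_dvd`; `a_p ≢ 1 ⟺ p ∤ #Ẽ(𝔽_p)` — the tree's
`dvd_reductionPointCount_iff_dvd_frobeniusTrace_sub_one`) -/


/-- **Every level with a non-zero Kurihara number has a `δ`-minimal divisor** (for a fixed system of
discrete logarithms `ψ`): induction on the level — either `d` itself is `δ`-minimal, or some proper
divisor carries a non-zero number and the induction hypothesis applies to it (Sakamoto 2022, proof of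
Cor. 1.9: "Theorem 1.2 shows that there is a `δ`-minimal integer"). Pure bookkeeping on
`Sakamoto2024.IsDeltaMinimal`. [cite: Sakamoto2022pSelmer, Def. 1.4 and proof of Cor. 1.9 (p. 4)] -/
theorem exists_isDeltaMinimal_dvd_of_kuriharaNumber_ne_zero {N : ℕ} (f : CuspForm (Gamma0 N) 2) (m : ℕ)
    (ψ : (ℓ : ℕ) → (ZMod ℓ)ˣ →* Multiplicative (ZMod m)) :
    ∀ (d : ℕ) [NeZero d], kuriharaNumber f m d ψ ≠ 0 →
      ∃ (e : ℕ) (_ : NeZero e), e ∣ d ∧ Sakamoto2024.IsDeltaMinimal f m e ψ := by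
  intro d
  induction d using Nat.strong_induction_on with
  | _ d ih =>
    intro hd hne
    by_cases hmin : Sakamoto2024.IsDeltaMinimal f m d ψ
    · exact ⟨d, hd, dvd_rfl, hmin⟩
    · have : ∃ (e : ℕ) (he : e ∈ d.properDivisors),
          (haveI : NeZero e := ⟨(Nat.pos_of_mem_properDivisors he).ne'⟩
           kuriharaNumber f m e ψ) ≠ 0 := by
        by_contra hall
        push Not at hall
        exact hmin ⟨hne, hall⟩
      obtain ⟨e, he, hene⟩ := this
      have hed : e ∣ d ∧ e < d := Nat.mem_properDivisors.mp he
      haveI : NeZero e := ⟨(Nat.pos_of_mem_properDivisors he).ne'⟩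
      obtain ⟨e', he', hdvd, hmin'⟩ := ih e hed.2 hene
      exact ⟨e', he', hdvd.trans hed.1, hmin'⟩

/-! ## §2 The E-side, EXACTLY: `Ш(E/ℚ)[p] = 0` ⟺ a unit Kurihara number at a cyclic level of depth `≤ rank E` -/


/-- **At a `δ`-minimal cyclic level `d`: `rank_ℤ E(ℚ) ≤ ν(d)`, and `Ш(E/ℚ)[p] = 0 ⟺ ν(d) = rank_ℤ E(ℚ)`**
(Sakamoto Thm. 1.5 read against the exact descent count `#Sel_p = p^{rank} · #E(ℚ)[p] · #Ш[p]` with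
`E(ℚ)[p] = 0`, `ρ̄` onto). `W` globally minimal, `p ≥ 5` good ordinary, `ρ̄_{E,p}` onto, `a_p ≢ 1`,
`p ∤ ord_v(Δ_min)` at multiplicative `v` (⟹ `p ∤ Tam`), `D` a datum with `p ∤ c_D` and the period transfer,
`ψ` surjective. In particular a `δ`-minimal cyclic level of depth `> rank E` is a FINITE CERTIFICATE of
`Ш(E/ℚ)[p] ≠ 0` (§5). CONDITIONAL on `hSak1`; per curve; BSD is not proved by it.
[cite: Sakamoto2022pSelmer, Thm. 1.5] [cite: SilvermanAEC2009, Thm. X.4.2] -/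
theorem rank_le_card_primeFactors_and_sha_iff_of_isDeltaMinimal
    (hSak1 : Literature.NumberTheory.EllipticCurves.Sakamoto2022_card_selmerGroup_eq_pow_of_isDeltaMinimal)
    (W : WeierstrassCurve ℚ) [W.IsElliptic] [W.IsGloballyMinimal] (p : ℕ) [hp : Fact p.Prime] (h5 : 5 ≤ p)
    (hgood : W.HasGoodReductionAtPrime p) (hord : ¬ (p : ℤ) ∣ W.frobeniusTrace p)
    (hsur : W.HasSurjectiveModNGaloisRep p) (hna : ¬ (p : ℤ) ∣ W.frobeniusTrace p - 1)
    (hKN : ∀ v : HeightOneSpectrum (𝓞 ℚ), W.HasMultiplicativeReductionAt v → ¬ p ∣ W.ordMinimalDiscriminant v)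
    {N : ℕ} [NeZero N] (D : ModularParametrizationData W N) (hc : ¬ (p : ℤ) ∣ D.maninConstant)
    (hu : ∃ u : ℚ, ‖(u : ℚ_[p])‖ = 1 ∧ W.realPeriodRat = u * plusPeriod D.f)
    (d : ℕ) [NeZero d] (hd : IsCyclicKolyvaginLevel W p d)
    (ψ : (ℓ : ℕ) → (ZMod ℓ)ˣ →* Multiplicative (ZMod p)) (hψ : ∀ ℓ ∈ d.primeFactors, Function.Surjective (ψ ℓ))
    (hmin : Sakamoto2024.IsDeltaMinimal D.f p d ψ) :
    W.mordellWeilRank ≤ d.primeFactors.card ∧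
      ((W.sha ⊓ AddSubgroup.torsionBy W.galH1 (p : ℤ) : AddSubgroup W.galH1) = ⊥ ↔
        d.primeFactors.card = W.mordellWeilRank) := by
  have hpP : p.Prime := hp.out
  have hirr : W.HasIrreducibleModPGaloisRep p := hasIrreducibleModPGaloisRep_of_hasSurjectiveModNGaloisRep W p hsur
  have htam : ¬ p ∣ W.tamagawaProduct := not_dvd_tamagawaProduct_of_kodairaNeron W p h5 hKN
  have hnap : ¬ p ∣ W.reductionPointCount p := fun h ↦
    hna ((dvd_reductionPointCount_iff_dvd_frobeniusTrace_sub_one W p).mp h)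
  have hcard : Nat.card (W.selmerGroup p) = p ^ d.primeFactors.card :=
    hSak1 W p h5 ⟨hgood, hord⟩ hsur hnap htam D hc hu d hd ψ hψ hmin
  -- exact descent count `#Sel_p = p^{rank} · #E(ℚ)[p] · #Ш[p]` with `#E(ℚ)[p] = 1`
  have hcount := W.natCard_selmerGroup_eq hpP.ne_zero
  have htor : Nat.card (AddSubgroup.torsionBy W.toAffine.Point (p : ℤ)) = 1 :=
    natCard_torsionBy_eq_one_of_hasIrreducibleModPGaloisRep W p hirr
  rw [hcard] at hcount
  -- abstract the arithmetic: `p^ν = p^r · t · s`, `t = 1` ⟹ `r ≤ ν` and (`s = 1 ↔ ν = r`)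
  have key : ∀ {ν r t s : ℕ}, p ^ ν = p ^ r * t * s → t = 1 → (r ≤ ν ∧ (s = 1 ↔ ν = r)) := by
    intro ν r t s h ht
    subst ht
    rw [mul_one] at h
    have hs : 0 < s := by
      rcases Nat.eq_zero_or_pos s with h0 | hpos
      · rw [h0, mul_zero] at h; exact absurd h (pow_ne_zero _ hpP.ne_zero)
      · exact hpos
    have hle : p ^ r ≤ p ^ ν := by rw [h]; exact Nat.le_mul_of_pos_right _ hs
    refine ⟨(Nat.pow_le_pow_iff_right hpP.one_lt).mp hle, ?_, ?_⟩
    · intro hs1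
      rw [hs1, mul_one] at h
      exact Nat.pow_right_injective hpP.two_le h
    · intro hνr
      subst hνr
      have hpow : 0 < p ^ ν := pow_pos hpP.pos _
      nth_rewrite 1 [← mul_one (p ^ ν)] at h
      exact (Nat.eq_of_mul_eq_mul_left hpow h).symm
  obtain ⟨hle, hiff⟩ := key hcount (by convert htor)
  refine ⟨hle, ?_⟩
  rw [← hiff, ← AddSubgroup.card_eq_one]

/-- **(⟸) A Kurihara bit of depth `≤ r` bounds the `p`-Selmer group: `#Sel_p(E/ℚ) ≤ p^r`.** The bit is
stated «for EVERY datum `D` at level `N_E` with `p ∤ c_D` and the period transfer, SOME cyclic level `n`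
with `ν(n) ≤ r` carries a unit mod-`p` Kurihara number» (the shape of a tree record's claim); a datum with
`p ∤ c_D` exists by modularity + Mazur 1978 Cor. 4.1 + Néron scaling (`X11b.exists_modularParametrizationData_not_dvd`)
and the period transfer by Mazur's corollary again (`SkinnerUrban2014.realPeriodRat_eq_unit_mul_plusPeriod_of_mazur`);
Kim's Thm. 1.11 bound (`hKim`) concludes. (g21's `natCard_selmerGroup_le_pow_of_kuriharaClaim` is the case
of a fixed level.) CONDITIONAL on `hKim`, `hnf`, `hMaz`; BSD is not proved by it.
[cite: Kim2022StructureSelmer, Thm. 1.11 (PDF p. 8)] [cite: Mazur1978, Cor. 4.1] -/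
theorem natCard_selmerGroup_le_pow_of_kuriharaBit
    (hKim : Kim2022_card_selmerGroup_le_pow_of_kuriharaNumber_ne_zero) (hnf : exists_isNewformOf)
    (hMaz : mazur_not_dvd_maninConstant_of_odd)
    (W : WeierstrassCurve ℚ) [W.IsElliptic] [W.IsGloballyMinimal] (p : ℕ) [hp : Fact p.Prime] (h5 : 5 ≤ p)
    (hgood : W.HasGoodReductionAtPrime p) (hord : ¬ (p : ℤ) ∣ W.frobeniusTrace p)
    (hsur : W.HasSurjectiveModNGaloisRep p) (hna : ¬ (p : ℤ) ∣ W.frobeniusTrace p - 1)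
    (hKN : ∀ v : HeightOneSpectrum (𝓞 ℚ), W.HasMultiplicativeReductionAt v → ¬ p ∣ W.ordMinimalDiscriminant v)
    [iNZ : NeZero (W.conductorNorm ℤ)] (r : ℕ)
    (hbit : ∀ (D : ModularParametrizationData W (W.conductorNorm ℤ)), ¬ (p : ℤ) ∣ D.maninConstant →
      (∃ u : ℚ, ‖(u : ℚ_[p])‖ = 1 ∧ W.realPeriodRat = u * plusPeriod D.f) →
      ∃ (n : ℕ) (_ : NeZero n), IsCyclicKolyvaginLevel W p n ∧ n.primeFactors.card ≤ r ∧
        ∃ ψ : (ℓ : ℕ) → (ZMod ℓ)ˣ →* Multiplicative (ZMod p),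
          (∀ ℓ ∈ n.primeFactors, Function.Surjective (ψ ℓ)) ∧ kuriharaNumber D.f p n ψ ≠ 0) :
    Nat.card (W.selmerGroup p) ≤ p ^ r := by
  have hpP : p.Prime := hp.out
  have hp2 : p ≠ 2 := by omega
  have hirr : W.HasIrreducibleModPGaloisRep p := hasIrreducibleModPGaloisRep_of_hasSurjectiveModNGaloisRep W p hsur
  have hpN : ¬ p ^ 2 ∣ W.conductorNorm ℤ := fun h ↦
    not_dvd_conductorNorm_of_hasGoodReductionAtPrime W hgood (dvd_trans (dvd_pow_self p two_ne_zero) h)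
  obtain ⟨D, hD⟩ := Summit.BirchSwinnertonDyer.Rank1Residual.X11b.exists_modularParametrizationData_not_dvd hnf hMaz
    integral_neronScaling_of_isGloballyMinimal_holds W rfl hpP hp2 hpN hirr
  have hc : ¬ (p : ℤ) ∣ D.maninConstant := hD
  have hu : ∃ u : ℚ, ‖(u : ℚ_[p])‖ = 1 ∧ W.realPeriodRat = u * plusPeriod D.f :=
    SkinnerUrban2014.realPeriodRat_eq_unit_mul_plusPeriod_of_mazur hMaz W p h5 hgood hirr D.f D.isNewformOf
  have ht0 : ∀ P : (W.baseChange ℚ_[p]).toAffine.Point, (p : ℤ) • P = 0 → P = 0 := fun P hP ↦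
    localTorsion_eq_zero_of_good_of_not_dvd_frobeniusTrace_sub_one W p (by omega) hgood hna P
      (by rw [← natCast_zsmul]; exact hP)
  have htam : ¬ p ∣ W.tamagawaProduct := not_dvd_tamagawaProduct_of_kodairaNeron W p h5 hKN
  obtain ⟨n, hn0, hn, hν, ψ, hψ, hne⟩ := hbit D hc hu
  exact (hKim W p h5 ⟨hgood, hord⟩ hsur ht0 htam D hc hu n hn ψ hψ hne).trans (Nat.pow_le_pow_right hpP.pos hν)

/-- **(⟹) A `p`-Selmer bound `#Sel_p(E/ℚ) ≤ p^r` yields a `δ`-MINIMAL cyclic Kurihara level of depth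
`≤ r`, for every admissible datum** (Sakamoto Thm. 1.2: a cyclic unit level exists — `hSak2`; its
`δ`-minimal divisor `e` (§1) has `#Sel_p = p^{ν(e)}` by Thm. 1.5 — `hSak1`; so `ν(e) ≤ r`). `W` globally
minimal, `p ≥ 5` good ordinary, `ρ̄_{E,p}` onto, `a_p ≢ 1`, Kodaira–Néron at `p`. CONDITIONAL on `hSak1`,
`hSak2`; BSD is not proved by it. [cite: Sakamoto2022pSelmer, Thm. 1.2 and Thm. 1.5] -/
theorem exists_isDeltaMinimal_of_natCard_selmerGroup_le_pow
    (hSak1 : Literature.NumberTheory.EllipticCurves.Sakamoto2022_card_selmerGroup_eq_pow_of_isDeltaMinimal)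
    (hSak2 : Literature.NumberTheory.EllipticCurves.Sakamoto2022_exists_cyclicLevel_kuriharaNumber_ne_zero)
    (W : WeierstrassCurve ℚ) [W.IsElliptic] [W.IsGloballyMinimal] (p : ℕ) [hp : Fact p.Prime] (h5 : 5 ≤ p)
    (hgood : W.HasGoodReductionAtPrime p) (hord : ¬ (p : ℤ) ∣ W.frobeniusTrace p)
    (hsur : W.HasSurjectiveModNGaloisRep p) (hna : ¬ (p : ℤ) ∣ W.frobeniusTrace p - 1)
    (hKN : ∀ v : HeightOneSpectrum (𝓞 ℚ), W.HasMultiplicativeReductionAt v → ¬ p ∣ W.ordMinimalDiscriminant v)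
    {r : ℕ} (hle : Nat.card (W.selmerGroup p) ≤ p ^ r)
    {N : ℕ} [NeZero N] (D : ModularParametrizationData W N) (hc : ¬ (p : ℤ) ∣ D.maninConstant)
    (hu : ∃ u : ℚ, ‖(u : ℚ_[p])‖ = 1 ∧ W.realPeriodRat = u * plusPeriod D.f) :
    ∃ (e : ℕ) (_ : NeZero e), IsCyclicKolyvaginLevel W p e ∧ e.primeFactors.card ≤ r ∧
      ∃ ψ : (ℓ : ℕ) → (ZMod ℓ)ˣ →* Multiplicative (ZMod p),
        (∀ ℓ ∈ e.primeFactors, Function.Surjective (ψ ℓ)) ∧ Sakamoto2024.IsDeltaMinimal D.f p e ψ := by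
  have hpP : p.Prime := hp.out
  have htam : ¬ p ∣ W.tamagawaProduct := not_dvd_tamagawaProduct_of_kodairaNeron W p h5 hKN
  have hnap : ¬ p ∣ W.reductionPointCount p := fun h ↦
    hna ((dvd_reductionPointCount_iff_dvd_frobeniusTrace_sub_one W p).mp h)
  obtain ⟨d, hd0, hd, ψ, hψ, hne⟩ := hSak2 W p h5 ⟨hgood, hord⟩ hsur hnap htam D hc hu
  obtain ⟨e, he0, hed, hmin⟩ := exists_isDeltaMinimal_dvd_of_kuriharaNumber_ne_zero D.f p ψ d hne
  have he : IsCyclicKolyvaginLevel W p e := KimAtThreeDeepUpperEndCore.EndCore.isCyclicKolyvaginLevel_of_dvd W p hd hed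
  have hψe : ∀ ℓ ∈ e.primeFactors, Function.Surjective (ψ ℓ) := fun ℓ hℓ ↦
    hψ ℓ (Nat.primeFactors_mono hed hd0.out hℓ)
  have hcard : Nat.card (W.selmerGroup p) = p ^ e.primeFactors.card :=
    hSak1 W p h5 ⟨hgood, hord⟩ hsur hnap htam D hc hu e he ψ hψe hmin
  refine ⟨e, he0, he, ?_, ψ, hψe, hmin⟩
  rw [hcard] at hle
  exact (Nat.pow_le_pow_iff_right hpP.one_lt).mp hle

end Summit.BirchSwinnertonDyer.BirchSwinnertonDyer.Theorems.KolyvaginDepthDoor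

end
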